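import Summits.ABC.StewartYu.PadicTwoThirdLog
import Summits.ABC.StewartYu.PadicW80Numeric3B
import Summits.ABC.StewartYu.PadicW80Budgets3
import Summits.ABC.StewartYu.PadicW80Par3E
import Summits.ABC.StewartYu.DescentIntegralityThirdQ
import Summits.ABC.StewartYu.DescentSizesQ
import Literature.NumberTheory.Transcendental.Waldschmidt1980SizeHyp
import HarnessLib

/-!
# Cell abc-stewartyu, W80Two (crux stmt-ABC-19486): the `q = 3` record discharges the numerical
# hypotheses of the `2`-adic machine — `hU8`, room, `KFinal3`, the third-step logarithmic inequalities,
# the endgame, Siegel's count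

`Summits/ABC/StewartYu/PadicTwoRecordNumerics.lean` — cell `abc-stewartyu` (HOME
`run/shared/lean/pub/abc-stewartyu/`, seat p1-g5 = record owner; route `PadicPrimesW80TwoThirds`, crux
`W80Two`); theorems only, no definition, no named fact.  For a `2`-adic set-up `S : TwoSetup` and a record
`P : PadicW80ParL S.d` with `ℓ = 1` (p3's `TwoSetup.recordOf`), at HALF multiplicity `t_J := ⌊tJ3 J/2⌋` and
with the closed forms `DmaxK3 k, MmaxK3 k` (inner steps) / `DmaxT3, MmaxT3` (third step) of
`PadicW80Par3`, the record's inequalities (`PadicW80Numeric3B.kstep3_h1/h2`, `PadicW80Budgets3`,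
`PadicW80Par3D.endgame_numbers3`, `PadicW80Par3E.padic_siegel_count3`) are EXACTLY the numerical
hypotheses of p2-g3's junctions `kFinal3_of_log_ineq`, `thirdStep_of_log_ineq`, `endgame3_of_numbers`,
`siegel3_of_count`:

* `PadicW80ParL.log_eight_le_U3`, `room3_of_half` — the fields `hU8` and the room at `⌊t_J/2⌋`;
* `PadicW80ParL.kfin3_h1/h2`, **`TwoSetup.kFinal3_of_record`** — the pack's field `hfin` outright;
* `PadicW80ParL.third3_h1/h2`, `TwoSetup.prod_max_one_abs_all_le`, **`TwoSetup.thirdStep_of_record`** —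
  `ThirdStep` at level `J` from the per-`(s,τ)` algebraic data and the two SIZE bounds `D ≤ DmaxT3`,
  `Mb ≤ MmaxT3` only;
* `PadicW80ParL.card_Pts3_top`, **`TwoSetup.endgame3_of_record`** — the pack's field `hend` outright;
* `PadicW80ParL.two_mul_card_Pts3_tauSet_le`, `TwoSetup.siegel_card3_of_record`,
  **`TwoSetup.siegel3_of_record`** — Siegel with the count discharged (coefficient data only remain).

[cite: Yu1989, §3 Lemmas 3.1–3.5] [cite: Waldschmidt1980, §§3.2–3.5 (pp. 264–274)]
-/

noncomputable section

open NormedSpace Finset IsUltrametricDist Real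
open Literature.NumberTheory.Transcendental
open Literature.NumberTheory.Transcendental.CW77 (hgt heightProd one_le_hgt abs_le_hgt)
open Literature.NumberTheory.Transcendental.CW77.Setup (Idx Tau tauNorm tauSet)
open Literature.NumberTheory.Transcendental.PadicCW77 (condExp)
open scoped Nat

namespace Summit.ABC.StewartYu

/-! ### Record side: the inequalities in the junctions' shapes -/

namespace PadicW80ParL

variable {d : ℕ} (P : PadicW80ParL d)

/-- `log 8 ≤ U` (`U = 3^{d+1}·𝔘 ≥ 𝔘 ≥ 2⁹⁶`). [folklore] -/
theorem log_eight_le_U3 : Real.log 8 ≤ P.Uℓ := by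
  have h8 : Real.log 8 = 3 * Real.log 2 := by
    rw [show (8 : ℝ) = 2 ^ 3 by norm_num, Real.log_pow]; norm_num
  have hU := P.𝔘3_ge'
  have h3 : P.𝔘3 ≤ P.Uℓ := by
    rw [P.U_eq3]
    have h1 : (1 : ℝ) ≤ 3 ^ (d + 1) := one_le_pow₀ (by norm_num)
    nlinarith [P.𝔘3_pos]
  have h96 : (3 : ℝ) ≤ 2 ^ 96 := by norm_num
  linarith [Real.log_two_lt_d9]

/-- `e^{−U} ≤ 8⁻¹`. [folklore] -/
theorem exp_neg_U3_le : Real.exp (-P.Uℓ) ≤ (8 : ℝ)⁻¹ := by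
  rw [← Real.exp_log (by norm_num : (0 : ℝ) < 8), ← Real.exp_neg, Real.exp_le_exp]
  exact neg_le_neg P.log_eight_le_U3

/-- **The room at half multiplicity**, in the junctions' shape: `|τ| < T/3^{J+1}` ⇒
`|τ| + ⌊t_J/2⌋ ≤ T/3ᴶ − d·⌊t_J/2⌋`. [cite: Yu1989, §3] -/
theorem room3_of_half (J : ℕ) {n : ℕ} (hn : n < P.T3 / 3 ^ (J + 1)) :
    n + P.tJ3 J / 2 ≤ P.T3 / 3 ^ J - d * (P.tJ3 J / 2) := by
  have h := P.room3_half J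
  have e : (d + 1) * (P.tJ3 J / 2) = d * (P.tJ3 J / 2) + P.tJ3 J / 2 := by ring
  omega

/-- Branch (1) of `KFinal3` at the `k`-th inner step (`k ≤ d`), half multiplicity, closed forms
`DmaxK3 k, MmaxK3 k`. [cite: Yu1989, §3 Lemma 3.3] -/
theorem kfin3_h1 (hℓ1 : P.ℓ = 1) {J : ℕ} (hJ : J < P.J₀3) {k : ℕ} (hk : k ≤ d) :
    ((P.hparℓ * P.Lb3 + P.tJ3 J / 2 + condExp 2 (3 ^ (k + J) * P.S₀3) (P.tJ3 J / 2) : ℕ) : ℝ) *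
        Real.log 2 + Real.log (P.DmaxK3 k * P.MmaxK3 k) < P.Uℓ := by
  refine P.kstep3_h1 hℓ1 hJ hk ((P.logDM3_le_budget k).trans ?_)
  have hU := P.𝔘3_pos
  have h3 : (0 : ℝ) ≤ 3 ^ k * P.𝔘3 := by positivity
  linarith

/-- Branch (2) of `KFinal3` at the `k`-th inner step, half multiplicity, closed forms.
[cite: Yu1989, §3 Lemma 3.3] -/
theorem kfin3_h2 (hℓ1 : P.ℓ = 1) {J : ℕ} (hJ : J < P.J₀3) (k : ℕ) :
    ((P.hparℓ * P.Lb3 : ℕ) : ℝ) * Real.log 8 + Real.log (P.DmaxK3 k * P.MmaxK3 k) <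
      ((2 * (3 ^ (k + J) * P.S₀3 / 3) * (P.tJ3 J / 2) : ℕ) : ℝ) * Real.log 4 := by
  refine P.kstep3_h2 hℓ1 hJ k ((P.logDM3_le_budget k).trans ?_)
  have hU := P.𝔘3_pos
  have h3 : (0 : ℝ) ≤ 3 ^ k * P.𝔘3 := by positivity
  linarith

/-- The third-step Liouville exponent as a real: `((3^{d+2} − 1 : ℕ) : ℝ) = 3^{d+2} − 1`. [folklore] -/
theorem cast_third_exponent (d : ℕ) : ((3 ^ (d + 1 + 1) - 1 : ℕ) : ℝ) = (3 : ℝ) ^ (d + 2) - 1 := by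
  rw [Nat.cast_sub (Nat.one_le_pow _ _ (by norm_num))]; push_cast; ring

/-- The third-step budget in the junction's shape: for `1 ≤ Hp ≤ e^{∑V + V_θ}`,
`(3^{d+2} − 1)·log(6·DmaxT3·MmaxT3·Hp) ≤ 𝔘/16 + 3^d·𝔘/2`. [cite: Yu1989, §3 Lemma 3.5] -/
theorem third3_budget {Hp : ℝ} (hHp1 : 1 ≤ Hp) (hHp : Hp ≤ Real.exp ((∑ j, P.V j) + P.Vθ)) :
    ((3 ^ (d + 1 + 1) - 1 : ℕ) : ℝ) * Real.log (6 * P.DmaxT3 * P.MmaxT3 * Hp) ≤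
      P.𝔘3 / 16 + 3 ^ d * P.𝔘3 / 2 := by
  rw [cast_third_exponent]
  have h := P.bthird_le_budget3' hHp1 hHp
  have hU := P.𝔘3_pos
  linarith

/-- Branch (1) of the third step at level `J` (half multiplicity, closed forms `DmaxT3, MmaxT3`,
height product `Hp ≤ e^{∑V+V_θ}`), in the shape of `thirdStep_of_log_ineq`'s `h1`.
[cite: Yu1989, §3 Lemmas 3.4–3.5] -/
theorem third3_h1 (hℓ1 : P.ℓ = 1) {J : ℕ} (hJ : J < P.J₀3) {Hp : ℝ} (hHp1 : 1 ≤ Hp)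
    (hHp : Hp ≤ Real.exp ((∑ j, P.V j) + P.Vθ)) :
    ((P.hparℓ * P.Lb3 + P.tJ3 J / 2 + condExp 2 (3 ^ (d + J) * P.S₀3) (P.tJ3 J / 2) : ℕ) : ℝ) *
          Real.log 2 +
        ((3 ^ (d + 1 + 1) - 1 : ℕ) : ℝ) * Real.log (6 * P.DmaxT3 * P.MmaxT3 * Hp) < P.Uℓ :=
  P.kstep3_h1 hℓ1 hJ le_rfl (P.third3_budget hHp1 hHp)

/-- Branch (2) of the third step at level `J`, in the shape of `thirdStep_of_log_ineq`'s `h2`.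
[cite: Yu1989, §3 Lemmas 3.4–3.5] -/
theorem third3_h2 (hℓ1 : P.ℓ = 1) {J : ℕ} (hJ : J < P.J₀3) {Hp : ℝ} (hHp1 : 1 ≤ Hp)
    (hHp : Hp ≤ Real.exp ((∑ j, P.V j) + P.Vθ)) :
    ((P.hparℓ * P.Lb3 : ℕ) : ℝ) * Real.log 8 +
        ((3 ^ (d + 1 + 1) - 1 : ℕ) : ℝ) * Real.log (6 * P.DmaxT3 * P.MmaxT3 * Hp) <
      ((2 * (3 ^ (d + J) * P.S₀3 / 3) * (P.tJ3 J / 2) : ℕ) : ℝ) * Real.log 4 :=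
  P.kstep3_h2 hℓ1 hJ d (P.third3_budget hHp1 hHp)

/-- **The number of points at the top level is `kpts3 J₀ 0`**: `#{s < 3^{J₀} S₀ : 3 ∤ s} = 2·3^{J₀}·(S₀/3)`
(`3 ∣ S₀`). [folklore] -/
theorem card_Pts3_top : (SetupQ.Pts3 (3 ^ P.J₀3 * P.S₀3)).card = P.kpts3 P.J₀3 0 := by
  rw [SetupQ.card_Pts3 (dvd_mul_of_dvd_right P.three_dvd_S₀3 _),
    Nat.mul_div_assoc _ P.three_dvd_S₀3]
  unfold kpts3
  ring

/-- The endgame count in the junction's shape: `h·L_b < T'·#Pts3(3^{J₀} S₀)` with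
`T' = ⌊T/3^{J₀}⌋ − ∑ⱼ ⌊Lⱼ/3^{J₀}⌋`. [cite: Waldschmidt1980, §3.5 (p. 274)] -/
theorem endgame3_count :
    P.hparℓ * P.Lb3 <
      (P.T3 / 3 ^ P.J₀3 - ∑ j, P.L3 j / 3 ^ P.J₀3) * (SetupQ.Pts3 (3 ^ P.J₀3 * P.S₀3)).card := by
  rw [P.card_Pts3_top]; exact P.endgame_numbers3.2

/-- The endgame budget: `T' + ∑ⱼ ⌊Lⱼ/3^{J₀}⌋ ≤ ⌊T/3^{J₀}⌋`. [cite: Waldschmidt1980, §3.5 (p. 274)] -/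
theorem endgame3_T' :
    (P.T3 / 3 ^ P.J₀3 - ∑ j, P.L3 j / 3 ^ P.J₀3) + ∑ j, P.L3 j / 3 ^ P.J₀3 ≤ P.T3 / 3 ^ P.J₀3 := by
  have := P.endgame_numbers3.1; omega

/-- `∏ᵢ (Lall3ᵢ + 1) = (∏ⱼ (L3ⱼ/3⁰ + 1))·(Lθ3/3⁰ + 1)` (the level-`0` box count in `card_box3`'s shape).
[folklore] -/
theorem prod_Lall3_succ_eq :
    ∏ i, (P.Lall3 i + 1) = (∏ j, (P.L3 j / 3 ^ 0 + 1)) * (P.Lθ3 / 3 ^ 0 + 1) := by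
  rw [Fin.prod_univ_castSucc]
  simp only [Lall3_castSucc, Lall3_last, pow_zero, Nat.div_one]

/-- **Siegel's count** in `card_box3`'s shape: `2·#(Pts3 S₀ × tauSet d T) ≤ h·L_b·∏(⌊Lⱼ/3⁰⌋+1)·(⌊L_θ/3⁰⌋+1)`
(`#Pts3 S₀ = 2 S₀/3 ≤ S₀` and `padic_siegel_count3`). [cite: Yu1989, §3 Lemma 3.1] -/
theorem two_mul_card_Pts3_tauSet_le (S : CW77.Setup) (P : PadicW80ParL S.d) :
    2 * (SetupQ.Pts3 P.S₀3 ×ˢ tauSet S.d P.T3).card ≤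
      P.hparℓ * P.Lb3 * ((∏ j, (P.L3 j / 3 ^ 0 + 1)) * (P.Lθ3 / 3 ^ 0 + 1)) := by
  rw [← P.prod_Lall3_succ_eq, card_product, SetupQ.card_Pts3 P.three_dvd_S₀3]
  have h := padic_siegel_count3 S P
  have hle : 2 * (P.S₀3 / 3) ≤ P.S₀3 := by omega
  calc 2 * (2 * (P.S₀3 / 3) * (tauSet S.d P.T3).card)
      ≤ 2 * (P.S₀3 * (tauSet S.d P.T3).card) :=
        Nat.mul_le_mul_left _ (Nat.mul_le_mul_right _ hle)
    _ ≤ _ := h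

end PadicW80ParL

/-! ### Set-up side: the pack's fields -/

namespace TwoSetup

variable (S : TwoSetup) (P : PadicW80ParL S.d)

/-- `1 ≤ ∏ᵢ max(1, |allᵢ|)`. [folklore] -/
theorem one_le_prod_max_one_abs_all : 1 ≤ ∏ i, max 1 |(S.toQ.all i : ℝ)| :=
  calc (1 : ℝ) = ∏ _i : Fin (S.d + 1), (1 : ℝ) := by simp
    _ ≤ ∏ i, max 1 |(S.toQ.all i : ℝ)| :=
      prod_le_prod (fun _ _ => zero_le_one) fun i _ => le_max_left _ _

/-- **`∏ᵢ max(1, |allᵢ|) ≤ e^{∑ⱼ Vⱼ + V_θ}`** under the size hypotheses (`max(1,|q|) ≤ H(q)`).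
[cite: Waldschmidt1980, §3.1 (3.1) (p. 263)] -/
theorem prod_max_one_abs_all_le (hy : S.toQ.flat.SizeHyp P.V P.Vθ P.W) :
    ∏ i, max 1 |(S.toQ.all i : ℝ)| ≤ Real.exp ((∑ j, P.V j) + P.Vθ) := by
  have h1 : ∏ i, max 1 |(S.toQ.all i : ℝ)| ≤ heightProd S.toQ.all :=
    prod_le_prod (fun i _ => le_trans zero_le_one (le_max_left _ _))
      fun i _ => max_le (one_le_hgt _) (abs_le_hgt _)
  have h2 := hy.heightProd_le
  rw [S.toQ.heightProd_flat_all, CW77.Setup.SizeHyp.sum_snoc] at h2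
  exact h1.trans h2

/-- **The pack's field `hfin`**: `‖Λ₀‖₂ ≤ e^{−U}` ⇒ `KFinal3` at every level `J < J₀`, half
multiplicity, closed forms `DmaxK3, MmaxK3`. [cite: Yu1989, §3 Lemma 3.3] -/
theorem kFinal3_of_record (hℓ1 : P.ℓ = 1) (hΛ : ‖S.Λ₀‖ ≤ Real.exp (-P.Uℓ)) {J : ℕ} (hJ : J < P.J₀3) :
    S.KFinal3 (h := P.hparℓ) (Lb := P.Lb3) J P.S₀3 (P.tJ3 J / 2) P.DmaxK3 P.MmaxK3 :=
  S.kFinal3_of_log_ineq J P.S₀3 (P.tJ3 J / 2) P.DmaxK3 P.MmaxK3 hΛ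
    (fun k _ => ⟨P.DmaxK3_pos k, P.MmaxK3_pos k⟩) (fun _ hk => P.kfin3_h1 hℓ1 hJ hk.le)
    fun k _ => P.kfin3_h2 hℓ1 hJ k

/-- **The third step at level `J` from sizes only**: given the algebraic data of
`thirdStep_of_log_ineq` (integer generators, cube-Kummer, the per-`(s,τ)` denominators `D` and sizes
`Mb`) and the two SIZE bounds `D ≤ DmaxT3`, `Mb ≤ MmaxT3`, the record discharges every numerical
hypothesis (`ht`, `hU8`, room, `h1`, `h2`). [cite: Yu1989, §3 Lemmas 3.4–3.5] -/
theorem thirdStep_of_record (hℓ1 : P.ℓ = 1) {J : ℕ} (hJ : J < P.J₀3)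
    (hΛ : ‖S.Λ₀‖ ≤ Real.exp (-P.Uℓ)) (hy : S.toQ.flat.SizeHyp P.V P.Vθ P.W)
    (hint : ∀ i, ∃ a : ℤ, S.toQ.all i = a)
    (hind : ∀ κ : Fin (S.d + 1) → ℕ, (∃ j, ¬ 3 ∣ κ j) → ∀ γ : ℚ, ∏ j, S.toQ.all j ^ κ j ≠ γ ^ 3)
    {Pint : ℤ} (D : ℕ → Tau S.d → ℕ) (hD : ∀ s τ, 1 ≤ D s τ)
    (hDc : ∀ s (τ : Tau S.d), ∀ u ∈ S.toQ.box3 (h := P.hparℓ) (Lb := P.Lb3) P.L3 P.Lθ3 J,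
      ∃ z : ℤ, (D s τ : ℚ) *
        ((S.toQ.qΔ3 P.J₀3 (J + 1) u τ.1 s * S.frame.qA u τ.2) * S.toQ.qEt u s) = z)
    (Mb : ℕ → Tau S.d → ℝ) (hMb : ∀ s τ, 1 ≤ Mb s τ)
    (hMbP : ∀ s (τ : Tau S.d), ∑ u ∈ S.toQ.box3 (h := P.hparℓ) (Lb := P.Lb3) P.L3 P.Lθ3 J,
      (Pint : ℝ) * |((S.toQ.qΔ3 P.J₀3 (J + 1) u τ.1 s * S.frame.qA u τ.2 * S.toQ.qEt u s : ℚ) : ℝ)| ≤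
        Mb s τ)
    (hDle : ∀ s τ, (D s τ : ℝ) ≤ P.DmaxT3) (hMle : ∀ s τ, Mb s τ ≤ P.MmaxT3) :
    S.ThirdStep (h := P.hparℓ) (Lb := P.Lb3) P.J₀3 J P.L3 P.Lθ3 P.S₀3 P.T3 (P.tJ3 J / 2) Pint :=
  S.thirdStep_of_log_ineq hJ (P.one_le_tJ3_half hJ) hΛ P.log_eight_le_U3
    (fun _ hτ => P.room3_of_half J hτ) hint hind D hD hDc Mb hMb hMbP hDle hMle
    (P.third3_h1 hℓ1 hJ (S.one_le_prod_max_one_abs_all) (S.prod_max_one_abs_all_le P hy))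
    (P.third3_h2 hℓ1 hJ (S.one_le_prod_max_one_abs_all) (S.prod_max_one_abs_all_le P hy))

/-- **The pack's field `hend`**: the endgame at level `J₀3` for ANY integer bound.
[cite: Waldschmidt1980, §3.5 (p. 274)] -/
theorem endgame3_of_record (Pint : ℤ) :
    S.Endgame3 (h := P.hparℓ) (Lb := P.Lb3) P.J₀3 P.L3 P.Lθ3 P.S₀3 P.T3 Pint :=
  S.endgame3_of_numbers P.endgame3_count P.Lθ3_lt_three_pow P.endgame3_T'

/-- **Siegel's count at level `0`**: `2·#(Pts3 S₀ × tauSet d T) ≤ #box3₀`. [cite: Yu1989, §3 Lemma 3.1] -/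
theorem siegel_card3_of_record :
    2 * (SetupQ.Pts3 P.S₀3 ×ˢ tauSet S.d P.T3).card ≤
      (S.toQ.box3 (h := P.hparℓ) (Lb := P.Lb3) P.L3 P.Lθ3 0).card := by
  rw [S.toQ.card_box3]
  exact PadicW80ParL.two_mul_card_Pts3_tauSet_le S.frame P

/-- **The pack's field `hsiegel` modulo the coefficient data**: Siegel's lemma at level `0` with the
count, `2 ≤ S₀`, `1 ≤ T` discharged by the record; the clearing denominators `Dc`, their
integrality and the bound `|Dc·qTerm3| ≤ Amax` remain. [cite: Yu1989, §3 Lemma 3.1] -/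
theorem siegel3_of_record (Dc : ℕ → Tau S.d → ℕ)
    (hDc : ∀ s, s < P.S₀3 → ¬ 3 ∣ s → ∀ τ : Tau S.d, tauNorm τ < P.T3 → 0 < Dc s τ)
    (hint : ∀ s, s < P.S₀3 → ¬ 3 ∣ s → ∀ τ : Tau S.d, tauNorm τ < P.T3 →
      ∀ u ∈ S.toQ.box3 (h := P.hparℓ) (Lb := P.Lb3) P.L3 P.Lθ3 0,
        ∃ z : ℤ, (Dc s τ : ℚ) * S.toQ.qTerm3 P.J₀3 0 u τ s = z)
    {Amax : ℝ} (hAmax : 1 ≤ Amax)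
    (hA : ∀ s, s < P.S₀3 → ¬ 3 ∣ s → ∀ τ : Tau S.d, tauNorm τ < P.T3 →
      ∀ u ∈ S.toQ.box3 (h := P.hparℓ) (Lb := P.Lb3) P.L3 P.Lθ3 0,
        |((Dc s τ : ℕ) : ℝ) * (S.toQ.qTerm3 P.J₀3 0 u τ s : ℝ)| ≤ Amax) :
    S.Siegel3 (h := P.hparℓ) (Lb := P.Lb3) P.J₀3 P.L3 P.Lθ3 P.S₀3 P.T3
      ⌈((S.toQ.box3 (h := P.hparℓ) (Lb := P.Lb3) P.L3 P.Lθ3 0).card : ℝ) * Amax⌉ :=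
  S.siegel3_of_count P.J₀3 P.L3 P.Lθ3 P.S₀3 P.T3 (le_trans (by norm_num) P.six_le_S₀3) P.one_le_T3
    (S.siegel_card3_of_record P) Dc hDc hint hAmax hA

end TwoSetup

end Summit.ABC.StewartYu

end
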